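import Literature.Analysis.SpecialFunctions.Dilogarithm
import Literature.Analysis.SpecialFunctions.DilogarithmRealArgument
import Mathlib.Analysis.SpecialFunctions.Trigonometric.Basic
import HarnessLib

/-!
# The exact two-loop mass-dependent QED anomaly coefficient `A_2^{(4)}(1/x)` (Elend 1966; Passera's dilogarithm form)

CITATION HEADER (venture `QEDPrecision`, cell `pub-qed`; typed PUBLISHED closed form only — no physics asserted).
M. Passera, *Precise mass-dependent QED contributions to leptonic g−2 at order α² and α³*, Phys. Rev. D 75,
013002 (2007) = arXiv:hep-ph/0606174, §2 eq. (4) [Passera2007] (held text p4), VERBATIM, with `x = m_j/m_l` the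
mass ratio of the loop lepton `j` to the external lepton `l` and `Li₂(z) = −∫₀^z (dt/t) ln(1−t)`:
```
A_2^{(4)}(1/x) = −25/36 − (ln x)/3 + x² (4 + 3 ln x)
  + (x/2)(1 − 5x²) [ π²/2 − ln x · ln((1−x)/(1+x)) − Li₂(x) + Li₂(−x) ]
  + x⁴ [ π²/3 − 2 ln x · ln(1/x − x) − Li₂(x²) ] .
```
"The exact expression for 0 < x < 1 was reported by Elend in 1966 [H. H. Elend, Phys. Lett. 20 (1966) 682;
21 (1966) 720(E)] … cast in [Passera 2005] in a very simple and compact analytic form, valid, contrary to the one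
in [El66], also for x ≥ 1"; "For x = 1, (4) gives A_2^{(4)}(1) = 119/36 − π²/3".

Typing choices (read before use):
* `Li₂` is the tree's SERIES dilogarithm `Literature.Analysis.SpecialFunctions.realDilog`
  (`Σ_{n≥1} zⁿ/n²`), which equals the dilogarithm only for `|z| ≤ 1`. Hence `a2Four x` IS the printed
  function for `0 < x ≤ 1` and is NOT a faithful typing for `x > 1` (there the printed form uses the
  analytically continued `Li₂`, absent from Mathlib v4.32).
* Which regime is which: Passera's variable is `x = m_j/m_l` (loop lepton over external lepton) and the
  function is written `A_2^{(4)}(1/x)`. Muon anomaly with an electron loop: `x = m_e/m_μ < 1` — series regime,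
  served faithfully here. Electron anomaly with a muon or tau loop: `x = m_μ/m_e, m_τ/m_e > 1` — NOT served by
  this typing; that case is evaluated in print by the heavy-mass expansion (WP20 §7.3.1; Passera §2) or by the
  continued closed form, and the cell's VP2mass certificates must say which they use.
* Junk values: `Real.log` of a non-positive argument is Mathlib's junk `log |·|`/`0`; irrelevant on `0 < x < 1`.
* `a2Four_one : a2Four 1 = 119/36 − π²/3` — the printed `x = 1` check value, PROVED for this typing.
* `a2FourCont` (added 2026-08-20) — THE SAME PRINTED FORMULA typed for every `x > 0`, with `Li₂` the
  dilogarithm of a REAL argument `Literature.Analysis.SpecialFunctions.reDilog` (Morris 1979: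
  `−∫₀ˣ log|1−t|/t dt`, equal to the series on `[−1,1]` and to `Re Li₂` beyond `1`; file
  `DilogarithmRealArgument.lean`, with the inversion formulas proved). Why this is the printed function
  also for `x > 1`: `A_2^{(4)}(1/x)` is real, so it equals the real part of the printed expression
  (principal branches, either side of the cut); every product in eq. (4) has at most one non-real
  factor (`x`, `ln x` are real for `x > 0`), so the real part is taken term by term — `log ↦ log|·|`
  (which is Mathlib's `Real.log`) and `Li₂ ↦ Re Li₂ = reDilog`. `a2FourCont_eq_a2Four`: the two typings
  agree on `|x| ≤ 1`; `a2FourCont_one`. (The cell's certificate `certs/VP2mass`, formulation (C),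
  evaluates exactly this real-part reading and agrees with two integral representations to ≤ 1e-20 at
  `x = m_μ/m_e, m_τ/m_e, m_τ/m_μ` — a numerical cross-check, not an input.)
Deliberately NOT here: numerical facts (the printed values `A_2^{(4)}(m_e/m_μ) = 5.197 386 70 (28)×10⁻⁷`
etc. depend on measured mass ratios); the three-loop `A_2^{(6)}` forms (Laporta 1993; Laporta–Remiddi 1993).
-/

noncomputable section

open Real

namespace Literature.MathematicalPhysics.QuantumFieldTheory.Passera2007

open Literature.Analysis.SpecialFunctions (realDilog reDilog reDilog_eq_realDilog)

/-- Passera 2007 eq. (4): the printed closed form of `A_2^{(4)}(1/x)` as a function of `x = m_j/m_l`, with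
`Li₂ := realDilog` (series; faithful for `0 < x ≤ 1`, see the module docstring). [cite: Passera2007, eq. (4)] -/
def a2Four (x : ℝ) : ℝ :=
  -25 / 36 - log x / 3 + x ^ 2 * (4 + 3 * log x)
    + x / 2 * (1 - 5 * x ^ 2) *
        (π ^ 2 / 2 - log x * log ((1 - x) / (1 + x)) - realDilog x + realDilog (-x))
    + x ^ 4 * (π ^ 2 / 3 - 2 * log x * log (1 / x - x) - realDilog (x ^ 2))

/-- Unfolding lemma (the definition, restated for rewriting). [cite: Passera2007, eq. (4)] -/
theorem a2Four_def (x : ℝ) :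
    a2Four x = -25 / 36 - log x / 3 + x ^ 2 * (4 + 3 * log x)
      + x / 2 * (1 - 5 * x ^ 2) *
          (π ^ 2 / 2 - log x * log ((1 - x) / (1 + x)) - realDilog x + realDilog (-x))
      + x ^ 4 * (π ^ 2 / 3 - 2 * log x * log (1 / x - x) - realDilog (x ^ 2)) := rfl

/-- **The printed `x = 1` check value holds for this typing**: "For x = 1, (4) gives
`A_2^{(4)}(1) = 119/36 − π²/3`" (Passera 2007, §2, sentence after eq. (4); this is the equal-mass
vacuum-polarisation value, "already part of A_1^{(4)}"). Proved for `a2Four` with the series `Li₂`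
(`Li₂(1) = π²/6`, `Li₂(−1) = −π²/12`, `Literature.Analysis.SpecialFunctions.realDilog_one/_neg_one`) —
an exact faithfulness certificate of the transcription of eq. (4). (At `x = 1` the printed terms
`ln x · ln((1−x)/(1+x))` and `2 ln x · ln(1/x − x)` are `0 ·` a logarithm of `0`; as limits `x → 1⁻` they
vanish, and Lean's junk value `log 0 = 0` gives the same `0`, so the evaluation is the printed one.)
[cite: Passera2007, §2 (sentence after eq. (4))] -/
theorem a2Four_one : a2Four 1 = 119 / 36 - π ^ 2 / 3 := by
  unfold a2Four
  rw [one_pow, one_pow, Real.log_one, Literature.Analysis.SpecialFunctions.realDilog_one,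
    Literature.Analysis.SpecialFunctions.realDilog_neg_one]
  ring

/-- **Passera 2007 eq. (4) for every `x > 0`** — the printed closed form of `A_2^{(4)}(1/x)` with
`Li₂ := reDilog`, the dilogarithm of a real argument (Morris 1979, `−∫₀ˣ log|1−t|/t dt`; `= Re Li₂(x)`
for `x > 1`), and the logarithms Mathlib's `Real.log = log|·|`: the term-by-term real part of the
printed expression, which is the printed (real) quantity since "[the form is] valid, contrary to the
one in [El66], also for `x ≥ 1` (the case relevant to `a_e` and part of `a_μ`)". See the module
docstring for why the real part may be taken term by term. [cite: Passera2007, eq. (4)] -/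
def a2FourCont (x : ℝ) : ℝ :=
  -25 / 36 - log x / 3 + x ^ 2 * (4 + 3 * log x)
    + x / 2 * (1 - 5 * x ^ 2) *
        (π ^ 2 / 2 - log x * log ((1 - x) / (1 + x)) - reDilog x + reDilog (-x))
    + x ^ 4 * (π ^ 2 / 3 - 2 * log x * log (1 / x - x) - reDilog (x ^ 2))

/-- Unfolding lemma for `a2FourCont`. [cite: Passera2007, eq. (4)] -/
theorem a2FourCont_def (x : ℝ) :
    a2FourCont x = -25 / 36 - log x / 3 + x ^ 2 * (4 + 3 * log x)
      + x / 2 * (1 - 5 * x ^ 2) *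
          (π ^ 2 / 2 - log x * log ((1 - x) / (1 + x)) - reDilog x + reDilog (-x))
      + x ^ 4 * (π ^ 2 / 3 - 2 * log x * log (1 / x - x) - reDilog (x ^ 2)) := rfl

/-- The two typings of eq. (4) agree on `|x| ≤ 1` (there `x, −x, x²` all lie in `[−1, 1]`, where the
real-argument dilogarithm IS the series: `reDilog_eq_realDilog`, Morris 1979 eq. (2)).
[cite: Passera2007, eq. (4)] -/
theorem a2FourCont_eq_a2Four {x : ℝ} (hx : |x| ≤ 1) : a2FourCont x = a2Four x := by
  have h2 : |(-x)| ≤ 1 := by rwa [abs_neg]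
  have h3 : |x ^ 2| ≤ 1 := by rw [abs_pow]; exact pow_le_one₀ (abs_nonneg x) hx
  rw [a2FourCont_def, a2Four_def, reDilog_eq_realDilog hx, reDilog_eq_realDilog h2,
    reDilog_eq_realDilog h3]

/-- The printed `x = 1` check value for the all-`x` typing: `A_2^{(4)}(1) = 119/36 − π²/3`.
[cite: Passera2007, §2 (sentence after eq. (4))] -/
theorem a2FourCont_one : a2FourCont 1 = 119 / 36 - π ^ 2 / 3 := by
  rw [a2FourCont_eq_a2Four (by norm_num), a2Four_one]

end Literature.MathematicalPhysics.QuantumFieldTheory.Passera2007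

end
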